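import Summits.QuantumFields.YangMills.Theorems.BalabanUVNodesPortRecordRepresentationS1StubLZdetTwin
import Summits.QuantumFields.YangMills.Theorems.BalabanUVNodesPortS1LZdetGlue

/-!
# Crux `PortRecordRepresentationS1` (stmt-QuantumFields-27930), line `pta-residueW` — THE PORTER's GLUE `stub_LZdetGlue` IS A THEOREM OUTRIGHT (v3.3∕v3.4 registered statement, v3.4 signature):
# `∀ F, P0HolExtAtRecordGL F → G3CAtRecordL F → PortRecordLZdetHalf F`, by ✓`lzdetHalf_of_twin_GL` and the landed twin ✓`stub_LZdetTwin`

Cell `ym-nodeO-ideate`, porter seat `ymgap-nodeO-port-PTA-1` (gen 8, lead of the line); `--supports stmt-QuantumFields-27930`.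
THE GAUSSIAN BRACKET OF `log Z^{(k)}` AT THE RECORD ([16] (63) on `[0, R]`, [I] (2.11)–(2.12)) IS IN THM 3's FORMAT MODULO TWO DISPLAYED LETTERS: the guarded L-edition of the P0-ℂ letter
`P0HolExtAtRecordGL` ([15] Prop. 9 ∕ Thm 1 (E2) at the record's (2.11) carrier with unit-lattice decay; supplier node00-def-Y) and the repaired located gap `G3CAtRecordL` ([16] (23)–(25)∕[B9] (3.90) at that
carrier; hand-27930-G3C).  Everything between those letters and the residue — the (63) germ identity, localization of the power members, their analyticity ∕ (1.18) bound ∕ (1.7) locality ∕ (1.19)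
invariance, the unit subtraction, the germ's membership in the record spaces, the integer twin and its cover bridge ((1.21)), the packaging — is kernel-checked in this lineage's `…PortS1LZdet*` files.

HONEST FRAMING.  A composition of landed theorems over DISPLAYED letters (inhabited NOWHERE); NOTHING of Bałaban's renormalization-group estimates asserted, ported or discharged; the crux 27930 ⁸-Ax-LR4
is OPEN · no claim (open registered stubs: `stub_P0C`, `stub_G3C`, `stub_FE`); NODE O 0∕1; COUNT 8∕28 · K 1∕4 UNMOVED; finite `𝕋⁴_{L^K}` at fixed ε — NOT continuum ∕ OS ∕ Clay; **the Yang–Mills mass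
gap is NOT proved by any of this.**  No `sorry`; standard axioms.
-/

namespace Summit.QuantumFields.YangMills.Theorems.BalabanUVNodesPortS1

/-- ★★★ **THE PORTER's GLUE `stub_LZdetGlue` OF THE LINE `pta-residueW`, OUTRIGHT**: the P0-ℂ letter (guarded L-edition) and the G3C letter (repaired) give the Gaussian sub-half of ⁸ at the record.
[cite: Balaban1985UV3, (63) p.272, (23)–(25) p.262; Balaban1987RG1, (2.11)–(2.14) pp.267–268, (1.18)–(1.19) p.263, (1.21) p.264; Balaban1985Variational, Prop. 9 p.309] -/
theorem stub_LZdetGlue : ∀ F, Summit.QuantumFields.YangMills.Theorems.K0RecordFormatNames.P0HolExtAtRecordGL F →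
    Summit.QuantumFields.YangMills.Theorems.BalabanUVNodesPortS1.G3CAtRecordL F →
    Summit.QuantumFields.YangMills.Theorems.BalabanUVNodesPortS1.PortRecordLZdetHalf F :=
  fun F hP hG => lzdetHalf_of_twin_GL F (stub_LZdetTwin F) hP hG

end Summit.QuantumFields.YangMills.Theorems.BalabanUVNodesPortS1
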